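import Mathlib
import Literature.Topology.FourManifolds.MMSWRasmussenFacts
import Literature.Topology.FourManifolds.MMSWFibreRotation
import HarnessLib

/-!
# MMSWBeltTwistInvariance

Topic `Literature/Topology/FourManifolds`. Named literature fact(s) relocated by the gate from `Summits/SmoothPoincare4/SmoothPoincare4/Theorems/DottedCircleRasmussenDcrGapStubSectorBlindPerHandle.lean`
(accept-time relocation of `[cite]`d propositions written inline in a Summits proposal; human ruling 2026-08-15).
Sources: ManolescuMarengonSarkarWillis2023.

* `Literature.Topology.FourManifolds.eventually_approxHasRasmussen_multiIndex`
-/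

namespace Literature.Topology.FourManifolds

open scoped Manifold ContDiff Topology ComplexConjugate
open Function Set
open Literature.Topology.FourManifolds Literature.Topology.FourManifolds.MMSW
open Literature.AlgebraicTopology.Homotopy.HopfFibration (zC wC ofZW zC_ofZW wC_ofZW ofZW_zC_wC)

/-- **The Rasmussen invariants of the finite approximations do not see the Dehn twists along the
belt spheres, eventually (Manolescu–Marengon–Sarkar–Willis, Thm. 3.7 with Thm. 3.3).**  For a
null-homologous model knot `K ⊂ M_r = ∂D_r` (`MMSW.IsModelKnot`, `MMSW.IsNullHomologous`) missing
the core circles (`w ≠ 0` along `K`) and every `ε ∈ ℤʳ`, let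
`τ^ε = MMSW.fibreRot (z ↦ Π_j ((z - c_j)/|z - c_j|)^{ε_j})` be the per-handle twist — the product
`Π_j σ_j^{ε_j}` of powers of the Dehn twists `σ_j` along the `r` belt spheres `{pt} × S²`, an
orientation-preserving self-diffeomorphism of `M_r ≅ #ʳ(S¹ × S²)` (MMSW §2.3; `τ^{(k,…,k)}` is the
tree's `MMSW.sphereTwist r k`).  Then for all sufficiently large `k ∈ ℤ` the finite approximations
`D(k⃗)(τ^ε ∘ K) = MMSW.finiteApprox r k (τ^ε ∘ K)` and `D(k⃗)(K) = MMSW.finiteApprox r k K` — knots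
in `S³` — have the same ordinary Rasmussen invariants (read through the tree's
`MMSW.ApproxHasRasmussen`, i.e. `Knot.HasRasmussenInvariant`): `s(D(k⃗)(τ^ε ∘ K)) = s(D(k⃗)(K))`.
Since `σ^k ∘ τ^ε = fibreRot (Π_j u_j^{k + ε_j})`, the left knot is MMSW's multi-index approximation
`D(k⃗ + ε)(K)` (`ε_j` further right-handed full twists through the `j`-th handle), so this says
`s(D(k⃗ + ε)) = s(D(k⃗))` for `k ≫ 0`.  In [MMSW]: `s(φ(L)) = s(L)` for every null-homologous link
`L ⊂ #ʳ(S¹ × S²)` and every orientation-preserving self-diffeomorphism `φ` (Thm. 3.7; for the Dehn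
twists "the re-indexing, which preserves Lee generators without shifts in the null-homologous
case", cf. the proof of Thm. 2.8: "`σ_i` simply adds a full twist … effectively changing `k` to
`k ± 1`"), both sides being computed by finite approximation from their standard diagrams,
`s(L) = s(D(k⃗))` for all `k ≥ ⌈(n⁺_D + 2)/2⌉` (Thm. 3.3 = Thm. 1.4, Prop. 8.2 (i)); with Rasmussen's
theorem that `s` of a knot in `S³` is single-valued this is the displayed `↔`.  Rests on
Khovanov–Lee homology in `#ʳ(S¹ × S²)` (Rozansky–Willis stabilisation), absent from the tree; the
diagonal companion is `MMSW.eventually_approxHasRasmussen`.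
-- TODO(general form): `s(φ(L)) = s(L)` for links and all of `π₀ Diff⁺(#ʳ(S¹ × S²))` (handle slides,
-- permutations and rotations of summands as well as the belt-sphere Dehn twists).
[cite: ManolescuMarengonSarkarWillis2023, Thm. 3.7 and Thm. 3.3] [file Topology/FourManifolds/MMSWBeltTwistInvariance] -/
def eventually_approxHasRasmussen_multiIndex : Prop :=
  ∀ {r : ℕ} {K : (Metric.sphere (0 : EuclideanSpace ℝ (Fin 2)) 1) → EuclideanSpace ℝ (Fin 4)} (_hK : Literature.Topology.FourManifolds.MMSW.IsModelKnot r K) (_h0 : Literature.Topology.FourManifolds.MMSW.IsNullHomologous r K) (_hw : ∀ t, Literature.AlgebraicTopology.Homotopy.HopfFibration.wC (K t) ≠ 0) (ε : Fin r → ℤ), ∃ k₀ : ℤ, ∀ k : ℤ, k₀ ≤ k → ∀ s : ℤ, Literature.Topology.FourManifolds.MMSW.ApproxHasRasmussen r k (Literature.Topology.FourManifolds.MMSW.fibreRot (fun z : ℂ => ∏ j : Fin r, ((z - Literature.Topology.FourManifolds.MMSW.holeCentre r j) / (((‖z - Literature.Topology.FourManifolds.MMSW.holeCentre r j‖ : ℝ))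 : ℂ)) ^ (ε j)) ∘ K) s ↔ Literature.Topology.FourManifolds.MMSW.ApproxHasRasmussen r k K s

end Literature.Topology.FourManifolds
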